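import Mathlib
import Summits.Ventures.PercRepro2.ZMeanProof
import Summits.Ventures.PercRepro2.PendantRoot
import Summits.Ventures.PercRepro2.PocketTransport
import Summits.Ventures.PercRepro2.PocketBHK
import Summits.Ventures.PercRepro2.PocketMasses
import Summits.Ventures.PercRepro2.HarrisRows
import Summits.Ventures.PercRepro2.HMFLeaf
import Summits.Ventures.PercRepro2.HMFLeafStep
import Summits.Ventures.PercRepro2.StarGlue
import Summits.Ventures.PercRepro2.StarOAlgebra
import Summits.Ventures.PercRepro2.StarOKappa
import Summits.Ventures.PercRepro2.StarOKappaCert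
import Summits.Ventures.PercRepro2.StarOEvents
import Summits.Ventures.PercRepro2.StarOProb
import Summits.Ventures.PercRepro2.StarOEvAlgMain
import Summits.Ventures.PercRepro2.StarOMain
import Summits.Ventures.PercRepro2.HMFStarLeafO

/-!
# (HMF) on the class «a₃ pendant at u, N(u) = {a₁, a₂, o, a₃}» (blind cell PercRepro2, night-1 g8;
NIGHT1-G8.md §9)

The attachment coefficient `κ` of the leaf is `kappaMassO` of the class-O table at `u`
(`HMFStarLeafO.kappa_star_eq`); the κ-certificate `StarO.classO_kappa_nonneg` and the BHK / Harris
slacks of the table give `κ ≥ 0` (`kappa_star_nonneg`), and the leaf step closes the class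
(`HMF_star_leaf_o`, `HCov_star_leaf_o`).
-/

open scoped Classical

namespace Summit.Ventures.PercRepro2

open UnionCluster CovForm PendantRoot StarGlue StarO

namespace HMFStarLeafO

variable {V : Type*} {E : Type*} [Fintype E] [DecidableEq E] [Fintype V] [DecidableEq V]
  {R : Type*} [Field R] [LinearOrder R] [IsStrictOrderedRing R]

variable {p : E → R} {ends : E → Sym2 V} {f f₁ f₂ f₃ : E} {a₃ u a₁ a₂ o : V}

section Kappa

variable (hp : IsProbVec p) (hf : ends f = s(a₃, u)) (hf₁ : ends f₁ = s(u, a₁)) (hf₂ : ends f₂ = s(u, a₂))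
  (hf₃ : ends f₃ = s(u, o)) (hleaf : ∀ e, a₃ ∈ ends e → e = f)
  (hstar : ∀ e, u ∈ ends e → e = f ∨ e = f₁ ∨ e = f₂ ∨ e = f₃) (h3u : a₃ ≠ u) {b : V}
  (h3o : a₃ ≠ o) (h31 : a₃ ≠ a₁) (h32 : a₃ ≠ a₂) (h3b : a₃ ≠ b) (hu1 : u ≠ a₁) (hu2 : u ≠ a₂)
  (huo : u ≠ o) (hub : u ≠ b) (h12 : a₁ ≠ a₂) (h1o : a₁ ≠ o) (h2o : a₂ ≠ o)

include hp hf hf₁ hf₂ hf₃ hleaf hstar h3u h3o h31 h32 h3b hu1 hu2 huo hub h12 h1o h2o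

omit hleaf h3b h12 h1o h2o in
/-- **The attachment coefficient of the class is nonnegative**: `kappaMassO` of the class-O table at
`u` in the loop graph is `≥ 0` (the κ-certificate `classO_kappa_nonneg` with the BHK / Harris slacks
of the table; `Z₁ = 0` separately). -/
theorem kappa_star_nonneg :
    0 ≤ kappaTable p (Function.update ends f s(a₃, a₃)) u o a₁ a₂ b (p f₁) (p f₂) (p f₃) := by
  unfold kappaTable
  -- the loop graph and its star at `u`
  set ends' := Function.update ends f s(a₃, a₃) with hends'
  obtain ⟨hf₁', hf₂', hf₃', hstar'⟩ := star_loop ends hf hf₁ hf₂ hf₃ hstar h3u h31 h32 h3o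
  set q := pOut p ends' u with hq
  have hqp : IsProbVec q := PocketConn.IsProbVec.zeroOn hp _
  have sBH := prob_Q_split_o (o := o) (a₁ := a₁) (a₂ := a₂) ends' q (connEvent ends' a₂ b)
  have sBL := prob_Q_split_o (o := o) (a₁ := a₁) (a₂ := a₂) ends' q (connEvent ends' a₁ b)
  rw [sBH, sBL]
  by_cases hZ : prob q (avoidAll ends' a₂ {a₁}) = 0
  · -- every mass vanishes
    have hle : ∀ X, prob q (avoidAll ends' a₂ {a₁} ∩ X) = 0 := fun X =>
      le_antisymm (hZ ▸ prob_mono hqp Set.inter_subset_left) (prob_nonneg hqp _)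
    have hcob : cobMass q ends' o a₁ a₂ b = 0 := by
      unfold cobMass
      exact le_antisymm (hZ ▸ prob_mono hqp (by
        intro ω hω; exact hω.1.1.1.1.1)) (prob_nonneg hqp _)
    have hG : PocketConn.Eprod' q ends' o a₁ a₂ b = 0 := by
      have h1 := PocketConn.Eprod'_le q ends' hqp o a₁ a₂ b
      have h2 : 0 ≤ PocketConn.Eprod' q ends' o a₁ a₂ b := by
        unfold PocketConn.Eprod'
        refine expect_nonneg hqp fun ω => ?_
        refine mul_nonneg (mul_nonneg ?_ ?_) (Set.indicator_nonneg (fun _ _ => zero_le_one) _)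
        · exact prob_nonneg hqp _
        · exact prob_nonneg hqp _
      have h3 : prob q (connEvent ends' a₁ o ∩ connEvent ends' a₁ b ∩ (connEvent ends' a₂ a₁)ᶜ) = 0 := by
        refine le_antisymm (hZ ▸ prob_mono hqp ?_) (prob_nonneg hqp _)
        rintro ω ⟨_, hQ⟩
        rw [avoidAll_eq_compl]
        exact fun h => hQ (conn_symm h)
      linarith
    have hG' : PocketConn.Eprod' q ends' o a₂ a₁ b = 0 := by
      have h1 := PocketConn.Eprod'_le q ends' hqp o a₂ a₁ b
      have h2 : 0 ≤ PocketConn.Eprod' q ends' o a₂ a₁ b := by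
        unfold PocketConn.Eprod'
        refine expect_nonneg hqp fun ω => ?_
        refine mul_nonneg (mul_nonneg ?_ ?_) (Set.indicator_nonneg (fun _ _ => zero_le_one) _)
        · exact prob_nonneg hqp _
        · exact prob_nonneg hqp _
      have h3 : prob q (connEvent ends' a₂ o ∩ connEvent ends' a₂ b ∩ (connEvent ends' a₁ a₂)ᶜ) = 0 := by
        refine le_antisymm (hZ ▸ prob_mono hqp ?_) (prob_nonneg hqp _)
        rintro ω ⟨_, hQ⟩
        rw [avoidAll_eq_compl]
        exact hQ
      linarith
    simp only [hle, hZ, hcob, hG, hG', kappaMassO, qoLMass, qoHMass, qbHMass, qbLMass, zMass, dMass,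
      doMass, wMass, eq3Mass, eq3oMass, xhatMass]
    ring_nf
    exact le_refl _
  · have hZpos : 0 < prob q (avoidAll ends' a₂ {a₁}) :=
      lt_of_le_of_ne (prob_nonneg hqp _) (Ne.symm hZ)
    -- the events of the BHK / Harris lemmas in the table's form
    have eQ : (connEvent ends' a₂ a₁)ᶜ = avoidAll ends' a₂ {a₁} := by
      rw [avoidAll_eq_compl, connEvent_comm]
    have eQ' : (connEvent ends' a₁ a₂)ᶜ = avoidAll ends' a₂ {a₁} := (avoidAll_eq_compl _ _ _).symm
    have eXQ : ∀ X : Set (Config E), X ∩ avoidAll ends' a₂ {a₁} = avoidAll ends' a₂ {a₁} ∩ X :=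
      fun X => Set.inter_comm _ _
    have eXYQ : ∀ X Y : Set (Config E), X ∩ Y ∩ avoidAll ends' a₂ {a₁} =
        avoidAll ends' a₂ {a₁} ∩ Y ∩ X := by
      intro X Y; ext ω; simp only [Set.mem_inter_iff]; tauto
    have hsLH : 0 ≤ prob q (avoidAll ends' a₂ {a₁} ∩ connEvent ends' a₁ o) *
        prob q (avoidAll ends' a₂ {a₁} ∩ connEvent ends' a₂ b) -
        prob q (avoidAll ends' a₂ {a₁}) *
          prob q (avoidAll ends' a₂ {a₁} ∩ connEvent ends' a₁ o ∩ connEvent ends' a₂ b) := by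
      have h := PocketConn.bhk_cross_gshare q ends' hqp o a₁ a₂ b
      rw [eQ, eXYQ, eXQ, eXQ] at h
      linarith
    have hsHL : 0 ≤ prob q (avoidAll ends' a₂ {a₁} ∩ connEvent ends' a₂ o) *
        prob q (avoidAll ends' a₂ {a₁} ∩ connEvent ends' a₁ b) -
        prob q (avoidAll ends' a₂ {a₁}) *
          prob q (avoidAll ends' a₂ {a₁} ∩ connEvent ends' a₂ o ∩ connEvent ends' a₁ b) := by
      have h := PocketConn.bhk_cross_gshare q ends' hqp o a₂ a₁ b
      rw [eQ', eXYQ, eXQ, eXQ] at h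
      linarith
    have huLL : 0 ≤ prob q (avoidAll ends' a₂ {a₁}) * PocketConn.Eprod' q ends' o a₁ a₂ b -
        prob q (avoidAll ends' a₂ {a₁} ∩ connEvent ends' a₁ o) *
          prob q (avoidAll ends' a₂ {a₁} ∩ connEvent ends' a₁ b) := by
      have h := PocketConn.bhk_same_gshare q ends' hqp o a₁ a₂ b
      rw [eQ, eXQ, eXQ] at h
      linarith
    have huHH : 0 ≤ prob q (avoidAll ends' a₂ {a₁}) * PocketConn.Eprod' q ends' o a₂ a₁ b -
        prob q (avoidAll ends' a₂ {a₁} ∩ connEvent ends' a₂ o) *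
          prob q (avoidAll ends' a₂ {a₁} ∩ connEvent ends' a₂ b) := by
      have h := PocketConn.bhk_same_gshare q ends' hqp o a₂ a₁ b
      rw [eQ', eXQ, eXQ] at h
      linarith
    have hhLL : 0 ≤ prob q (avoidAll ends' a₂ {a₁} ∩ connEvent ends' a₁ o ∩ connEvent ends' a₁ b) -
        PocketConn.Eprod' q ends' o a₁ a₂ b := by
      have h := PocketConn.Eprod'_le q ends' hqp o a₁ a₂ b
      rw [eQ, eXYQ] at h
      have e : avoidAll ends' a₂ {a₁} ∩ connEvent ends' a₁ b ∩ connEvent ends' a₁ o =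
          avoidAll ends' a₂ {a₁} ∩ connEvent ends' a₁ o ∩ connEvent ends' a₁ b := by
        rw [Set.inter_right_comm]
      rw [e] at h
      linarith
    have hhHH : 0 ≤ prob q (avoidAll ends' a₂ {a₁} ∩ connEvent ends' a₂ o ∩ connEvent ends' a₂ b) -
        PocketConn.Eprod' q ends' o a₂ a₁ b := by
      have h := PocketConn.Eprod'_le q ends' hqp o a₂ a₁ b
      rw [eQ', eXYQ] at h
      have e : avoidAll ends' a₂ {a₁} ∩ connEvent ends' a₂ b ∩ connEvent ends' a₂ o =
          avoidAll ends' a₂ {a₁} ∩ connEvent ends' a₂ o ∩ connEvent ends' a₂ b := by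
        rw [Set.inter_right_comm]
      rw [e] at h
      linarith
    have hAN : prob q (avoidAll ends' a₂ {a₁} ∩ connEvent ends' a₁ o) +
        prob q (avoidAll ends' a₂ {a₁} ∩ connEvent ends' a₂ o) ≤ prob q (avoidAll ends' a₂ {a₁}) := by
      have h := prob_Q_split_o (o := o) (a₁ := a₁) (a₂ := a₂) ends' q Set.univ
      simp only [Set.inter_univ] at h
      have := prob_nonneg hqp (avoidAll ends' a₂ {a₁} ∩ (connEvent ends' o a₁)ᶜ ∩ (connEvent ends' o a₂)ᶜ)
      linarith
    have hX0 := termW_singleton_eq p ends' hu1 hu2 huo hub hZ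
    rw [sBH, sBL] at hX0
    rw [sBH] at hsLH huHH
    rw [sBL] at hsHL huLL
    have hcob0 : 0 ≤ cobMass q ends' o a₁ a₂ b := by
      unfold cobMass; exact prob_nonneg hqp _
    have key := classO_kappa_nonneg (R := R) (cob := cobMass q ends' o a₁ a₂ b) hX0
      (prob_nonneg hqp _) (prob_nonneg hqp _) (prob_nonneg hqp _) hAN hcob0 hhLL hhHH hsLH hsHL
      huLL huHH (hp.nonneg f₁) (hp.le_one f₁) (hp.nonneg f₂) (hp.le_one f₂) (hp.nonneg f₃)
      (hp.le_one f₃)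
    exact (mul_nonneg_iff_of_pos_left hZpos).1 key

/-- **(HMF) — hence (HCOV) — for `a₃` pendant at a vertex `u` adjacent only to `a₁`, `a₂`, `o`**
(NIGHT1-G8.md §9): the leaf step with (i) `HMF_contract_star_o` and (ii) `kappa_star_nonneg`. -/
theorem HMF_star_leaf_o : HMF p ends o a₁ a₂ a₃ b :=
  HMF_star_leaf_o_of_kappa hp hf hf₁ hf₂ hf₃ hleaf hstar h3u h3o h31 h32 h3b hu1 hu2 huo hub h12
    h1o h2o (kappa_star_nonneg hp hf hf₁ hf₂ hf₃ hstar h3u h3o h31 h32 hu1 hu2 huo hub)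

/-- **(HCOV) on the class.** -/
theorem HCov_star_leaf_o : CovForm.HCov p ends o a₁ a₂ a₃ b :=
  HCov_of_HMF p hp ends o a₁ a₂ a₃ b
    (HMF_star_leaf_o hp hf hf₁ hf₂ hf₃ hleaf hstar h3u h3o h31 h32 h3b hu1 hu2 huo hub h12 h1o h2o)

end Kappa

end HMFStarLeafO

end Summit.Ventures.PercRepro2
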